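import Literature.Probability.RandomPlanarGeometry.HexSAWStripSurfaceAdsorbedLocality
import Literature.Probability.RandomPlanarGeometry.HexSAWSurfaceWallRenewalCubeRange
import HarnessLib

/-!
# Exponential strip locality of the adsorbed honeycomb walk down to `y > μ³`: `0 ≤ log μ(y) − log μ_T(y,1) ≤ E₃(y)·θ₃(y)^{T+1}`

Topic `Literature/Probability/RandomPlanarGeometry` (lane «pcv-sawmu», a-p6 g19, car «ADSORBED-LOCALITY-CUBE»; parents, all TREE:
`HexSAWStripSurfaceAdsorbedLocality.lean` (a-idea-1, door «ADSORBED-STRIP-LOCALITY»: for EVERY `y > 0` the strip of height `T` captures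
the renewal mass of the blocks of half-length `≤ T`, `sq_wallRate_mul_sum_pwbLaw_le : β(y)²·Σ_{k≤T} f_k(y) ≤ μ_T(y,1)²`, plus the
finite-data certificates `inv_le_sq_wallRate_of_certificate`, `sq_wallRate_mul_sum_pwbLaw_le_inv`; and, for `y > μ⁴`, the exponential
locality `|log μ(y) − log μ_T(y,1)| ≤ E θ^{T+1}` with `θ = μ²/√y`), `HexSAWSurfaceWallRenewalCubeRange.lean` (a-p6 g19: Kesten's relation
`hasSum_pwbLaw_of_cube_lt` and the envelope `pwbLaw_le_geom_cube : f_s ≤ (μ² + y^{2/3}/μ²)·θ₃^s`, `θ₃ = μ²/y^{2/3} < 1` iff `y > μ³`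
(`theta_cube_lt_one`), from the six-step law of `HexSAWSurfaceWallRenewalSixStep.lean` (a-idea-1 g33)), `HexSAWStripSurfaceRateAllY.lean` /
`HexSAWStripSurfaceLimit.lean` (`stripMuY₀`, `stripMuY₀_le_surfaceMu`, `stripMuY₀_pos`), `HexSAWSurfaceWallRateEq.lean`
(`HV.wallRate_eq_surfaceMu : β(y) = μ(y)`)).

WHAT IS PROVED — the parent's §4/§6 VERBATIM IN FORM with `θ = μ²/√y`, `E = μ²√y/(1−θ)`, `y > μ⁴` replaced by
`θ₃ = μ²/y^{2/3}`, `E₃ = (μ² + y^{2/3}/μ²)/(1−θ₃)`, `y > μ³ = (2+√2)^{3/2} ≈ 6.31`: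
* `one_sub_envelope_le_sum_pwbLaw_of_cube_lt : 1 − E₃ θ₃^{T+1} ≤ Σ_{k≤T} f_k(y)` (every `T`);
* ★★ `sq_surfaceMu_mul_le_sq_stripMuY₀_of_cube_lt : μ(y)²(1 − E₃ θ₃^{T+1}) ≤ μ_T(y,1)²` (every `T ≥ 1`);
* ★★ `log_surfaceMu_sub_log_stripMuY₀_le_envelope_of_cube_lt`, `abs_log_surfaceMu_sub_log_stripMuY₀_le_envelope_of_cube_lt` — once
  `E₃ θ₃^{T+1} ≤ 1/2`: `0 ≤ log μ(y) − log μ_T(y,1) ≤ E₃ θ₃^{T+1}` — EXPONENTIAL STRIP LOCALITY ON `y > μ³`, against the all-fugacity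
  rate `(22 + 2|log y|)/√T` of `HexSAWStripSurfaceRateAllY`; `eventually_abs_log_surfaceMu_sub_log_stripMuY₀_le_of_cube_lt` (all large `T`);
* `sq_wallRate_mul_one_sub_envelope_le_inv_of_cube_lt`, `truncated_root_bounds_of_cube_lt` — the finite-data (truncated Kesten root)
  enclosures of `μ(y)² = β(y)²` converge exponentially in the truncation order, now for `y > μ³`.

HONEST LABEL.  LANE THEOREM (range extension), DERIVED: the parent's all-`y` capture inequality plus the six-step envelope of
`HexSAWSurfaceWallRenewalCubeRange`; the mechanism (truncating the renewal / Kesten relation) is classical [MadrasSlade1993, §4.2,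
(4.2.4) and Theorem 4.2.2 (pp. 90–92); Kesten1963SAW, §4]; locality / strip limits of honeycomb walks in print:
[BeatonBousquetMelouDeGierDuminilCopinGuttmann2014, Propositions 6–7 (arXiv v5 pp. 10–12)], [HammersleyWelsh1962, Theorem].  NEW IN
WRITING (modest): the exponential rate of strip locality for the surface-weighted honeycomb walk on the explicit range `y > (2+√2)^{3/2}`
(parent: `y > (2+√2)²`).  NOT CLAIMED: anything for `y ≤ μ³`; optimality of the rate `θ₃`; numerics.  No definitions.
-/

noncomputable section

open Finset Filter Function
open Literature.Probability.LatticeModels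
open _root_.Topology

namespace Literature.Probability.RandomPlanarGeometry.SAW.HexBW.Wall

variable {y : ℝ}

/-! ### §1 Private numerics for the `μ³` range -/

/-- [folklore] `μ³ < y` forces `1 ≤ y` (`μ ≥ 1`). -/
private theorem one_le_of_mu_cube_lt_aslc (hy : hexConnectiveConstant ^ 3 < y) : 1 ≤ y :=
  (one_le_pow₀ one_le_hexConnectiveConstant).trans hy.le

/-- [folklore] `0 < y` from `μ³ < y`. -/
private theorem pos_of_mu_cube_lt_aslc (hy : hexConnectiveConstant ^ 3 < y) : 0 < y :=
  one_pos.trans_le (one_le_of_mu_cube_lt_aslc hy)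

/-- [folklore] `0 < θ₃(y) = μ²/y^{2/3}` for `0 < y`. -/
private theorem theta_cube_pos_aslc (hy : 0 < y) : 0 < hexConnectiveConstant ^ 2 / y ^ ((2 : ℝ) / 3) :=
  div_pos (pow_pos hexConnectiveConstant_pos 2) (Real.rpow_pos_of_pos hy _)

/-! ### §2 The adsorbed regime `y > μ³`: the strip captures the renewal mass of the short pieces -/

/-- **The missing mass is exponentially small**: `1 − E θ₃^{T+1} ≤ Σ_{k ≤ T} f_k(y)` with `θ₃ = μ²/y^{2/3}`, `E = (μ² + y^{2/3}/μ²)/(1−θ₃)`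
(`y > μ³`; the Kesten relation and the geometric envelope `f_s ≤ (μ² + y^{2/3}/μ²) θ₃^s` of the parent).
[cite: MadrasSlade1993, §4.2, (4.2.4) and remark before (4.2.21) (pp. 91, 94); Feller1968, XIII.3] -/
theorem one_sub_envelope_le_sum_pwbLaw_of_cube_lt (hy : hexConnectiveConstant ^ 3 < y) (T : ℕ) :
    1 - (hexConnectiveConstant ^ 2 + y ^ ((2 : ℝ) / 3) / hexConnectiveConstant ^ 2) / (1 - hexConnectiveConstant ^ 2 / y ^ ((2 : ℝ) / 3)) *
        (hexConnectiveConstant ^ 2 / y ^ ((2 : ℝ) / 3)) ^ (T + 1) ≤ ∑ k ∈ range (T + 1), pwbLaw y k := by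
  have hy0 := pos_of_mu_cube_lt_aslc hy
  have hy1 := one_le_of_mu_cube_lt_aslc hy
  set θ := hexConnectiveConstant ^ 2 / y ^ ((2 : ℝ) / 3) with hθ
  have hθ0 : 0 < θ := theta_cube_pos_aslc hy0
  have hθ1 : θ < 1 := theta_cube_lt_one hy
  set A := hexConnectiveConstant ^ 2 + y ^ ((2 : ℝ) / 3) / hexConnectiveConstant ^ 2 with hA
  have hsum := hasSum_pwbLaw_of_cube_lt hy
  have hsplit := hsum.summable.sum_add_tsum_nat_add (T + 1)
  rw [hsum.tsum_eq] at hsplit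
  have hshift : Summable fun k => pwbLaw y (k + (T + 1)) := (summable_nat_add_iff (T + 1)).2 hsum.summable
  have hgeo : Summable fun k : ℕ => A * θ ^ (T + 1) * θ ^ k := (summable_geometric_of_lt_one hθ0.le hθ1).mul_left _
  have htail : ∑' k, pwbLaw y (k + (T + 1)) ≤ A * θ ^ (T + 1) * (1 - θ)⁻¹ := by
    calc ∑' k, pwbLaw y (k + (T + 1)) ≤ ∑' k : ℕ, A * θ ^ (T + 1) * θ ^ k := by
          refine Summable.tsum_le_tsum (fun k => ?_) hshift hgeo
          calc pwbLaw y (k + (T + 1)) ≤ A * θ ^ (k + (T + 1)) := pwbLaw_le_geom_cube hy1 _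
            _ = A * θ ^ (T + 1) * θ ^ k := by rw [pow_add]; ring
      _ = A * θ ^ (T + 1) * (1 - θ)⁻¹ := by rw [tsum_mul_left, tsum_geometric_of_lt_one hθ0.le hθ1]
  have hE : A / (1 - θ) * θ ^ (T + 1) = A * θ ^ (T + 1) * (1 - θ)⁻¹ := by rw [div_eq_mul_inv]; ring
  rw [hE]
  linarith

/-- **Exponential strip locality, quadratic form** (`y > μ³`, every `T ≥ 1`):
`μ(y)² · (1 − E θ₃^{T+1}) ≤ μ_T(y,1)²` with `θ₃ = μ²/y^{2/3}`, `E = (μ² + y^{2/3}/μ²)/(1−θ₃)` (and `μ_T(y,1) ≤ μ(y)` by `stripMuY₀_le_surfaceMu`).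
[cite: MadrasSlade1993, §4.2, (4.2.4) and Theorem 4.2.2 (pp. 90–92); BeatonBousquetMelouDeGierDuminilCopinGuttmann2014, Proposition 7 (arXiv v5 p. 11)] -/
theorem sq_surfaceMu_mul_le_sq_stripMuY₀_of_cube_lt (hy : hexConnectiveConstant ^ 3 < y) {T : ℕ} (hT : 1 ≤ T) :
    HV.surfaceMu y ^ 2 * (1 - (hexConnectiveConstant ^ 2 + y ^ ((2 : ℝ) / 3) / hexConnectiveConstant ^ 2) / (1 - hexConnectiveConstant ^ 2 / y ^ ((2 : ℝ) / 3)) *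
        (hexConnectiveConstant ^ 2 / y ^ ((2 : ℝ) / 3)) ^ (T + 1)) ≤ stripMuY₀ T y ^ 2 := by
  have hy0 := pos_of_mu_cube_lt_aslc hy
  rw [← HV.wallRate_eq_surfaceMu hy0]
  exact (mul_le_mul_of_nonneg_left (one_sub_envelope_le_sum_pwbLaw_of_cube_lt hy T) (sq_nonneg _)).trans
    (sq_wallRate_mul_sum_pwbLaw_le hy0 hT)

/-- **Exponential strip locality** (`y > μ³`): once `E θ₃^{T+1} ≤ 1/2` (`T ≥ 1`),
`log μ(y) − log μ_T(y,1) ≤ E θ₃^{T+1}` — against the all-fugacity rate `(22 + 2|log y|)/√T` of `HexSAWStripSurfaceRateAllY`.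
(`−½ log(1−t) ≤ ½ · t/(1−t) ≤ t` for `t ≤ 1/2`.)
[cite: MadrasSlade1993, §4.2, Theorem 4.2.2 (pp. 91–92); BeatonBousquetMelouDeGierDuminilCopinGuttmann2014, Propositions 6–7 (arXiv v5 pp. 10–12); HammersleyWelsh1962, Theorem] -/
theorem log_surfaceMu_sub_log_stripMuY₀_le_envelope_of_cube_lt (hy : hexConnectiveConstant ^ 3 < y) {T : ℕ} (hT : 1 ≤ T)
    (hsmall : (hexConnectiveConstant ^ 2 + y ^ ((2 : ℝ) / 3) / hexConnectiveConstant ^ 2) / (1 - hexConnectiveConstant ^ 2 / y ^ ((2 : ℝ) / 3)) *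
        (hexConnectiveConstant ^ 2 / y ^ ((2 : ℝ) / 3)) ^ (T + 1) ≤ 1 / 2) :
    Real.log (HV.surfaceMu y) - Real.log (stripMuY₀ T y) ≤
      (hexConnectiveConstant ^ 2 + y ^ ((2 : ℝ) / 3) / hexConnectiveConstant ^ 2) / (1 - hexConnectiveConstant ^ 2 / y ^ ((2 : ℝ) / 3)) *
        (hexConnectiveConstant ^ 2 / y ^ ((2 : ℝ) / 3)) ^ (T + 1) := by
  have hy0 := pos_of_mu_cube_lt_aslc hy
  set t := (hexConnectiveConstant ^ 2 + y ^ ((2 : ℝ) / 3) / hexConnectiveConstant ^ 2) / (1 - hexConnectiveConstant ^ 2 / y ^ ((2 : ℝ) / 3)) *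
        (hexConnectiveConstant ^ 2 / y ^ ((2 : ℝ) / 3)) ^ (T + 1) with ht
  have hθ1 := theta_cube_lt_one hy
  have ht0 : 0 ≤ t := by
    have : 0 < 1 - hexConnectiveConstant ^ 2 / y ^ ((2 : ℝ) / 3) := by linarith
    positivity
  have h1t : 0 < 1 - t := by linarith
  have hμT := stripMuY₀_pos T hy0
  have hμ : 0 < HV.surfaceMu y := by rw [← HV.wallRate_eq_surfaceMu hy0]; exact wallRate_pos y
  have hsq := sq_surfaceMu_mul_le_sq_stripMuY₀_of_cube_lt hy hT
  have hlog := Real.log_le_log (mul_pos (pow_pos hμ 2) h1t) hsq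
  rw [Real.log_mul (pow_pos hμ 2).ne' h1t.ne', Real.log_pow, Real.log_pow] at hlog
  have hl1t : 1 - (1 - t)⁻¹ ≤ Real.log (1 - t) := Real.one_sub_inv_le_log_of_pos h1t
  have hinv : (1 - t)⁻¹ ≤ 1 + 2 * t := by
    rw [inv_eq_one_div, div_le_iff₀ h1t]
    nlinarith
  push_cast at hlog
  linarith

/-- **Two-sided form**: `|log μ(y) − log μ_T(y,1)| ≤ E θ₃^{T+1}` under the same hypotheses (the lower sign is
`μ_T(y,1) ≤ μ(y)`, `stripMuY₀_le_surfaceMu`).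
[cite: MadrasSlade1993, §4.2, Theorem 4.2.2 (pp. 91–92); BeatonBousquetMelouDeGierDuminilCopinGuttmann2014, Propositions 6–7 (arXiv v5 pp. 10–12)] -/
theorem abs_log_surfaceMu_sub_log_stripMuY₀_le_envelope_of_cube_lt (hy : hexConnectiveConstant ^ 3 < y) {T : ℕ} (hT : 1 ≤ T)
    (hsmall : (hexConnectiveConstant ^ 2 + y ^ ((2 : ℝ) / 3) / hexConnectiveConstant ^ 2) / (1 - hexConnectiveConstant ^ 2 / y ^ ((2 : ℝ) / 3)) *
        (hexConnectiveConstant ^ 2 / y ^ ((2 : ℝ) / 3)) ^ (T + 1) ≤ 1 / 2) :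
    |Real.log (HV.surfaceMu y) - Real.log (stripMuY₀ T y)| ≤
      (hexConnectiveConstant ^ 2 + y ^ ((2 : ℝ) / 3) / hexConnectiveConstant ^ 2) / (1 - hexConnectiveConstant ^ 2 / y ^ ((2 : ℝ) / 3)) *
        (hexConnectiveConstant ^ 2 / y ^ ((2 : ℝ) / 3)) ^ (T + 1) := by
  have hy0 := pos_of_mu_cube_lt_aslc hy
  have hnn : 0 ≤ Real.log (HV.surfaceMu y) - Real.log (stripMuY₀ T y) :=
    sub_nonneg.2 (Real.log_le_log (stripMuY₀_pos T hy0) (stripMuY₀_le_surfaceMu T hy0))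
  rw [abs_of_nonneg hnn]
  exact log_surfaceMu_sub_log_stripMuY₀_le_envelope_of_cube_lt hy hT hsmall

/-- **Eventually in `T`**: for `y > μ³`, `|log μ(y) − log μ_T(y,1)| ≤ E θ₃^{T+1}` for all large `T` (`θ^{T+1} → 0`).
[cite: MadrasSlade1993, §4.2, Theorem 4.2.2 (pp. 91–92); BeatonBousquetMelouDeGierDuminilCopinGuttmann2014, Propositions 6–7 (arXiv v5 pp. 10–12)] -/
theorem eventually_abs_log_surfaceMu_sub_log_stripMuY₀_le_of_cube_lt (hy : hexConnectiveConstant ^ 3 < y) :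
    ∀ᶠ T : ℕ in atTop, |Real.log (HV.surfaceMu y) - Real.log (stripMuY₀ T y)| ≤
      (hexConnectiveConstant ^ 2 + y ^ ((2 : ℝ) / 3) / hexConnectiveConstant ^ 2) / (1 - hexConnectiveConstant ^ 2 / y ^ ((2 : ℝ) / 3)) *
        (hexConnectiveConstant ^ 2 / y ^ ((2 : ℝ) / 3)) ^ (T + 1) := by
  have hy0 := pos_of_mu_cube_lt_aslc hy
  set θ := hexConnectiveConstant ^ 2 / y ^ ((2 : ℝ) / 3) with hθ
  set E := (hexConnectiveConstant ^ 2 + y ^ ((2 : ℝ) / 3) / hexConnectiveConstant ^ 2) / (1 - θ) with hE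
  have hθ0 : 0 < θ := theta_cube_pos_aslc hy0
  have hθ1 : θ < 1 := theta_cube_lt_one hy
  have hlim : Tendsto (fun T : ℕ => E * θ ^ (T + 1)) atTop (𝓝 0) := by
    have h := (tendsto_pow_atTop_nhds_zero_of_lt_one hθ0.le hθ1).comp (tendsto_add_atTop_nat 1)
    simpa using h.const_mul E
  have hev : ∀ᶠ T : ℕ in atTop, E * θ ^ (T + 1) ≤ 1 / 2 :=
    (hlim.eventually (Iic_mem_nhds (show (0 : ℝ) < 1 / 2 by norm_num))).mono fun T hT => hT
  filter_upwards [hev, eventually_ge_atTop 1] with T h1 h2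
  exact abs_log_surfaceMu_sub_log_stripMuY₀_le_envelope_of_cube_lt hy h2 h1

/-- **A sub-certificate certifies `β(y)²` up to the envelope** (`y > μ³`): if `Σ_{k=1}^{D} Λ_{2k}(y) x^k ≤ 1` with `x > 0` then
`β(y)² (1 − E θ₃^{D+1}) ≤ 1/x` (the form a rational under-approximation of the truncated root is fed into; combine with a rational
over-approximation and `one_le_sq_stripMuY₀_mul` / `inv_le_sq_wallRate_of_certificate` for a two-sided rational enclosure of `μ(y)²`).
[cite: MadrasSlade1993, §4.2, (4.2.4) and Theorem 4.2.2 (pp. 90–92); Kesten1963SAW, §4] -/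
theorem sq_wallRate_mul_one_sub_envelope_le_inv_of_cube_lt (hy : hexConnectiveConstant ^ 3 < y) {D : ℕ} (hD : 1 ≤ D) {x : ℝ} (hx : 0 < x)
    (hG : ∑ k ∈ Icc 1 D, IPWB (2 * k) y * x ^ k ≤ 1) :
    wallRate y ^ 2 * (1 - (hexConnectiveConstant ^ 2 + y ^ ((2 : ℝ) / 3) / hexConnectiveConstant ^ 2) / (1 - hexConnectiveConstant ^ 2 / y ^ ((2 : ℝ) / 3)) *
        (hexConnectiveConstant ^ 2 / y ^ ((2 : ℝ) / 3)) ^ (D + 1)) ≤ 1 / x :=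
  (mul_le_mul_of_nonneg_left (one_sub_envelope_le_sum_pwbLaw_of_cube_lt hy D) (sq_nonneg _)).trans
    (sq_wallRate_mul_sum_pwbLaw_le_inv (pos_of_mu_cube_lt_aslc hy) hD hx hG)

/-- **Exponential exhaustion of the certificates** (`y > μ³`): the `D`-th truncated Kesten root certifies at least
`β(y)²(1 − E θ₃^{D+1})` (and never more than `β(y)²`): the scheme of finite-data lower bounds converges to `μ(y)² = β(y)²`
exponentially fast in the truncation order. [cite: MadrasSlade1993, §4.2, (4.2.4) and Theorem 4.2.2 (pp. 90–92); Kesten1963SAW, §4] -/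
theorem truncated_root_bounds_of_cube_lt (hy : hexConnectiveConstant ^ 3 < y) {D : ℕ} (hD : 1 ≤ D) {x : ℝ} (hx : 0 < x)
    (hG : ∑ k ∈ Icc 1 D, IPWB (2 * k) y * x ^ k = 1) :
    wallRate y ^ 2 * (1 - (hexConnectiveConstant ^ 2 + y ^ ((2 : ℝ) / 3) / hexConnectiveConstant ^ 2) / (1 - hexConnectiveConstant ^ 2 / y ^ ((2 : ℝ) / 3)) *
        (hexConnectiveConstant ^ 2 / y ^ ((2 : ℝ) / 3)) ^ (D + 1)) ≤ 1 / x ∧ 1 / x ≤ wallRate y ^ 2 :=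
  ⟨sq_wallRate_mul_one_sub_envelope_le_inv_of_cube_lt hy hD hx hG.le,
    inv_le_sq_wallRate_of_certificate (pos_of_mu_cube_lt_aslc hy) hD hx hG.ge⟩

end Literature.Probability.RandomPlanarGeometry.SAW.HexBW.Wall

end
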